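import Summits.FinalStateConjecture.FinalStateConjecture.Theses.PenroseDeficitNorm
import Literature.Geometry.Lorentzian.HawkingMassFlux

/-!
# Strategy-census sketch — crux `GainFreeConesSettle` (stmt-FinalStateConjecture-17336),
# route `PenroseDeficitNorm` (crux-strategist seat planner-cstrat-stmt-FinalStateConjecture-17336-r1-0)

Kernel-checked companions of `STRATEGY-CENSUS.md`: the typed pieces of every decomposition that was
attempted (D-A … D-C) with their assemblies PROVED against the crux BY NAME (`E` below), and the typed
hand-over package for the pending planner re-type of the saturation predicate (`IsNormalised`,
`GainFreeConesSettleNormalised` = C′, its split P1/P2a/P2b with a proved assembly).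

Nothing in this file is filed as a route item: the crux as typed is HELD (refuted-misstated on paper,
three refuter verdicts on its predecessor stmt-FinalStateConjecture-10389), so every split whose assembly
is proved contains a piece that is false on paper (census, Decomposition section). `sorry` does not occur.

The last section, RE-TYPE KIT, gives the re-typed items E′ = C′, K1′, R′ with the normalisation
(N0)–(N3) INLINED over tree declarations (paste-ready bodies), the deciding theorem `closesR`
re-elaborated over them (proved), and the post-re-type split P1 (proved) / P2a / P2b with its assembly
`gainFreeConesSettleR_of_subs` (proved) — the move that WOULD have teeth, for the tenure planner / human.
-/

open Literature.Geometry.Lorentzian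
open scoped Manifold ContDiff Topology ENNReal
open Filter Set

set_option linter.dupNamespace false

noncomputable section

namespace Summit.FinalStateConjecture.FinalStateConjecture.Cruxes.GainFreeConesSettle.StrategyCensus

/-- The crux, by name. -/
abbrev E : Prop :=
  Summit.FinalStateConjecture.FinalStateConjecture.Theses.PenroseDeficitNorm.GainFreeConesSettle

section Helpers

variable {X : Type} [TopologicalSpace X] [ChartedSpace E3 X] [IsManifold (𝓡 3) ∞ X]
  [ConnectedSpace X] {D : InitialDataSet (𝓡 3) X}

/-- E's ray-theoretic event-horizon hypothesis, verbatim. -/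
def HasHorizon (𝒟 : VacuumCauchyDevelopment D) : Prop :=
  ∀ [𝒟.metric.HasLeviCivita], ∃ q : 𝒟.carrier, ∀ (p : X) (γ : ℝ → 𝒟.carrier) (dom : Set ℝ),
    𝒟.metric.IsNormalisedNullRayFrom 𝒟.timeOrientation 𝒟.embed 𝒟.normal p γ dom →
      ¬ BddAbove dom → q ∉ 𝒟.metric.chronologicalPast 𝒟.timeOrientation (γ '' (dom ∩ Set.Ici 0))

/-- The area of the inner cut `sec u 0` (E's `(totalArea …).toReal`, verbatim). -/
def innerArea {𝒟 : CauchyDevelopment D} (𝓕 : 𝒟.FutureBondiFoliation) (u : ℝ) : ℝ :=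
  (totalArea (𝒟.metric.inducedRiemannianMetric (𝓕.sec u 0) 𝓕.hpb (𝓕.isSpacelike u 0))).toReal

/-- The area of the cut `sec u s`. -/
def cutArea {𝒟 : CauchyDevelopment D} (𝓕 : 𝒟.FutureBondiFoliation) (u s : ℝ) : ℝ :=
  (totalArea (𝒟.metric.inducedRiemannianMetric (𝓕.sec u s) 𝓕.hpb (𝓕.isSpacelike u s))).toReal

/-- E's typed saturation predicate, clauses (i)–(iii), verbatim, bundled. -/
def IsSaturated {𝒟 : CauchyDevelopment D} (𝓕 : 𝒟.FutureBondiFoliation) (A : ℝ) : Prop :=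
  (∀ᶠ u in atTop, MonotoneOn (𝓕.sectionHawkingMass u) (Set.Ici 0)) ∧ 0 < A ∧
    Tendsto (innerArea 𝓕) atTop (𝓝 A) ∧
    Tendsto (fun u ↦ 𝓕.sectionHawkingMass u 0) atTop (𝓝 (Real.sqrt (A / (16 * Real.pi)))) ∧
    𝓕.finalBondiMass = Real.sqrt (A / (16 * Real.pi))

/-- PINCHING of the Hawking masses along the late cones towards `m`:
`sup_{s ≥ 0} |m_H(S_{u,s}) - m| → 0` as `u → ∞` (junk-free `∀ ε` form). -/
def IsPinched {𝒟 : CauchyDevelopment D} (𝓕 : 𝒟.FutureBondiFoliation) (m : ℝ) : Prop :=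
  ∀ ε : ℝ, 0 < ε → ∀ᶠ u in atTop, ∀ s : ℝ, 0 ≤ s → |𝓕.sectionHawkingMass u s - m| ≤ ε

/-- The T2 settling conclusion of the Statement (verbatim). -/
def SettlesT2 (𝒟 : VacuumCauchyDevelopment D) : Prop :=
  ∃ (O : Set 𝒟.carrier) (d : FinalStateDecomposition 𝒟.toSpacetime O 2),
    (∀ i, Kerr.IsSubextremal (d.mass i) (d.spin i)) ∧
    O = Summit.FinalStateConjecture.exteriorOf 𝒟.toCauchyDevelopment d.charted ∧
    Summit.FinalStateConjecture.RaysStayInClosure 𝒟.toCauchyDevelopment O ∧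
    Summit.FinalStateConjecture.HasExhaustiveCharts d ∧
    Summit.FinalStateConjecture.IsFutureOriented d

/-- E's conclusion (verbatim shape): T2 settling to ONE Schwarzschild hole of mass `m`. -/
def SettlesSchwarzschild (𝒟 : VacuumCauchyDevelopment D) (m : ℝ) : Prop :=
  ∃ (O : Set 𝒟.carrier) (d : FinalStateDecomposition 𝒟.toSpacetime O 2),
    (∀ i, Kerr.IsSubextremal (d.mass i) (d.spin i)) ∧
    O = Summit.FinalStateConjecture.exteriorOf 𝒟.toCauchyDevelopment d.charted ∧
    Summit.FinalStateConjecture.RaysStayInClosure 𝒟.toCauchyDevelopment O ∧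
    Summit.FinalStateConjecture.HasExhaustiveCharts d ∧
    Summit.FinalStateConjecture.IsFutureOriented d ∧ d.N = 1 ∧ ∀ i, d.spin i = 0 ∧ d.mass i = m

/-! ### The refuters' repair C′, typed over the landed D1 layer (`HawkingMassFlux.lean`) -/

/-- (N3) POINTWISE HUGGING of the inner leaf: `sup_y |θ_L θ_L̲|(S_{u,0}) → 0` (junk-free `∀ ε` form). -/
def IsHugging {𝒟 : CauchyDevelopment D} (𝓕 : 𝒟.FutureBondiFoliation) : Prop :=
  ∀ ε : ℝ, 0 < ε → ∀ᶠ u in atTop, ∀ y : 𝓕.surf,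
    haveI := 𝓕.hasLeviCivita
    |𝒟.metric.nullExpansion (𝓕.sec u 0) 𝓕.hpb (𝓕.isSpacelike u 0) (𝓕.pair u 0).L y *
      𝒟.metric.nullExpansion (𝓕.sec u 0) 𝓕.hpb (𝓕.isSpacelike u 0) (𝓕.pair u 0).Lbar y| ≤ ε

/-- (N2) ASYMPTOTIC ROUNDNESS of the far leaves of the late cones: `K · |S|/4π → 1` uniformly
(the intrinsic form used by `CauchyDevelopment.RoundSectionFamily.round`). -/
def IsAsymptoticallyRound {𝒟 : CauchyDevelopment D} (𝓕 : 𝒟.FutureBondiFoliation) : Prop :=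
  ∀ᶠ u in atTop, TendstoUniformly
    (fun s y ↦ 𝒟.metric.gaussCurvature (𝓕.sec u s) (𝓕.isSpacelike u s) y * cutArea 𝓕 u s /
      (4 * Real.pi))
    (fun _ ↦ (1 : ℝ)) atTop

/-- (N1) The late cones are ADAPTED (the leaves sweep `C_u` injectively and differentiably,
`L = ∂_s sec`, `BondiFoliation.IsAdaptedCone`) and AFFINELY parametrised outward of the inner leaf. -/
def IsAffinelyFoliated {𝒟 : CauchyDevelopment D} (𝓕 : 𝒟.FutureBondiFoliation) : Prop :=
  ∀ᶠ u in atTop, 𝓕.IsAdaptedCone u ∧ ∀ y : 𝓕.surf,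
    IsGeodesicOn (haveI := 𝒟.metric.toPseudoRiemannianMetric.hasLeviCivita; 𝒟.metric.leviCivita)
      (fun s ↦ 𝓕.sec u s y) (Set.Ioi 0)

/-- NORMALISED foliation = (N0) connected leaf type ∧ (N1) ∧ (N2) ∧ (N3): one admissible typing of the
refuters' repaired hypotheses (stmt-10389 notes 16:39Z (N1)–(N3), 20:24Z (N0),(N2),(N3)). -/
def IsNormalised {𝒟 : CauchyDevelopment D} (𝓕 : 𝒟.FutureBondiFoliation) : Prop :=
  ConnectedSpace 𝓕.surf ∧ IsAffinelyFoliated 𝓕 ∧ IsAsymptoticallyRound 𝓕 ∧ IsHugging 𝓕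

/-- Cone-level Schwarzschild(`m`) closeness of the late adapted cones, in the unit-lapse gauge of the
adapted pair: weighted shear, torsion and mass-aspect defect small on every leaf `s ≥ 0` and the leaf
Hawking masses within `ε` of `m` (the zero set of the null-Penrose flux density on Schwarzschild cones). -/
def ConesSchwarzschildClose {𝒟 : CauchyDevelopment D} (𝓕 : 𝒟.FutureBondiFoliation) (m : ℝ) :
    Prop :=
  ∀ ε : ℝ, 0 < ε → ∀ᶠ u in atTop, ∀ hu : 𝓕.IsAdaptedCone u, ∀ s : ℝ, 0 ≤ s →
    ∀ y : (LorentzianMetric.BondiFoliation.coneNullHypersurface hu).surf,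
      (LorentzianMetric.BondiFoliation.coneNullHypersurface hu).areaRadius s ^ 2 *
          ((LorentzianMetric.BondiFoliation.coneNullHypersurface hu).shearNormSq s y +
            (LorentzianMetric.BondiFoliation.coneNullHypersurface hu).torsionNormSq s y) +
        (LorentzianMetric.BondiFoliation.coneNullHypersurface hu).areaRadius s ^ 3 *
          |(LorentzianMetric.BondiFoliation.coneNullHypersurface hu).massAspect s y -
            (LorentzianMetric.BondiFoliation.coneNullHypersurface hu).meanMassAspect s| ≤ ε ∧
      |(LorentzianMetric.BondiFoliation.coneNullHypersurface hu).hawkingMass s - m| ≤ ε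

end Helpers

/-! ## Pieces -/

/-- P1 (provable now, pure order/filter analysis over `IsCanonical`): eventual outward monotonicity,
`m_H(S_{u,0}) → m` and `M_B(∞) = m` PINCH all late Hawking masses: `sup_{s ≥ 0}|m_H(S_{u,s}) − m| → 0`
(`m_H(u,0) ≤ m_H(u,s) ≤ M_B(u)` for `s ≥ 0` and late `u`; `M_B(u) ↓ M_B(∞)`). -/
def HawkingMassPinching : Prop :=
  ∀ (X : Type) [TopologicalSpace X] [ChartedSpace E3 X] [IsManifold (𝓡 3) ∞ X] [ConnectedSpace X],
    ∀ (D : InitialDataSet (𝓡 3) X) (𝒟 : CauchyDevelopment D) (e : AFEnd X)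
      (𝓕 : 𝒟.FutureBondiFoliation), 𝓕.IsCanonical e D →
      (∀ᶠ u in atTop, MonotoneOn (𝓕.sectionHawkingMass u) (Set.Ici 0)) →
      ∀ m : ℝ, Tendsto (fun u ↦ 𝓕.sectionHawkingMass u 0) atTop (𝓝 m) → 𝓕.finalBondiMass = m →
        IsPinched 𝓕 m

/-- D-A, piece X₂: PINCHED canonical cones (no monotonicity, no inner-mass clause) with inner areas `→ A`
and `M_B(∞) = √(A/16π)` settle to Schwarzschild(`M_B(∞)`). FALSE ON PAPER exactly like E (junk cuts). -/
def PinchedConesSettle : Prop :=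
  ∀ (X : Type) [TopologicalSpace X] [ChartedSpace E3 X] [IsManifold (𝓡 3) ∞ X] [T2Space X]
    [SecondCountableTopology X] [ConnectedSpace X],
    ∀ D ∈ admissibleVacuumData X, ∀ 𝒟 : VacuumCauchyDevelopment D, 𝒟.IsMaximal →
      Summit.FinalStateConjecture.HasCompleteNullInfinity 𝒟.toCauchyDevelopment → HasHorizon 𝒟 →
      ∀ (e : AFEnd X) (𝓕 : 𝒟.toCauchyDevelopment.FutureBondiFoliation), 𝓕.IsCanonical e D →
        IsPinched 𝓕 𝓕.finalBondiMass →
        ∀ A : ℝ, 0 < A → Tendsto (innerArea 𝓕) atTop (𝓝 A) →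
          𝓕.finalBondiMass = Real.sqrt (A / (16 * Real.pi)) →
            SettlesSchwarzschild 𝒟 𝓕.finalBondiMass

/-- D-B, piece X₁: saturated censored developments SETTLE in the T2 sense (no parameter rider).
∀-data final-state content on the typed-saturated sector. -/
def SaturatedDevelopmentsSettle : Prop :=
  ∀ (X : Type) [TopologicalSpace X] [ChartedSpace E3 X] [IsManifold (𝓡 3) ∞ X] [T2Space X]
    [SecondCountableTopology X] [ConnectedSpace X],
    ∀ D ∈ admissibleVacuumData X, ∀ 𝒟 : VacuumCauchyDevelopment D, 𝒟.IsMaximal →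
      Summit.FinalStateConjecture.HasCompleteNullInfinity 𝒟.toCauchyDevelopment → HasHorizon 𝒟 →
      ∀ (e : AFEnd X) (𝓕 : 𝒟.toCauchyDevelopment.FutureBondiFoliation), 𝓕.IsCanonical e D →
        ∀ A : ℝ, IsSaturated 𝓕 A → SettlesT2 𝒟

/-- D-B, piece X₂: on a saturated censored development EVERY T2 decomposition is one Schwarzschild hole
of mass `M_B(∞)` (parameter pinning / no-hair bookkeeping). FALSE ON PAPER for junk `𝓕` (mass ≠ M_f). -/
def SaturationPinsParameters : Prop :=
  ∀ (X : Type) [TopologicalSpace X] [ChartedSpace E3 X] [IsManifold (𝓡 3) ∞ X] [T2Space X]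
    [SecondCountableTopology X] [ConnectedSpace X],
    ∀ D ∈ admissibleVacuumData X, ∀ 𝒟 : VacuumCauchyDevelopment D, 𝒟.IsMaximal →
      Summit.FinalStateConjecture.HasCompleteNullInfinity 𝒟.toCauchyDevelopment → HasHorizon 𝒟 →
      ∀ (e : AFEnd X) (𝓕 : 𝒟.toCauchyDevelopment.FutureBondiFoliation), 𝓕.IsCanonical e D →
        ∀ A : ℝ, IsSaturated 𝓕 A →
          ∀ (O : Set 𝒟.carrier) (d : FinalStateDecomposition 𝒟.toSpacetime O 2),
            O = Summit.FinalStateConjecture.exteriorOf 𝒟.toCauchyDevelopment d.charted →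
            Summit.FinalStateConjecture.HasExhaustiveCharts d →
            Summit.FinalStateConjecture.IsFutureOriented d →
              d.N = 1 ∧ ∀ i, d.spin i = 0 ∧ d.mass i = 𝓕.finalBondiMass

/-- D-C, piece X₁ = C′: E restricted to NORMALISED foliations (the refuters' repaired statement; the
intended open content: equality in the null Penrose inequality along late cones ⇒ Schwarzschild end state). -/
def GainFreeConesSettleNormalised : Prop :=
  ∀ (X : Type) [TopologicalSpace X] [ChartedSpace E3 X] [IsManifold (𝓡 3) ∞ X] [T2Space X]
    [SecondCountableTopology X] [ConnectedSpace X],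
    ∀ D ∈ admissibleVacuumData X, ∀ 𝒟 : VacuumCauchyDevelopment D, 𝒟.IsMaximal →
      Summit.FinalStateConjecture.HasCompleteNullInfinity 𝒟.toCauchyDevelopment → HasHorizon 𝒟 →
      ∀ (e : AFEnd X) (𝓕 : 𝒟.toCauchyDevelopment.FutureBondiFoliation), 𝓕.IsCanonical e D →
        IsNormalised 𝓕 → ∀ A : ℝ, IsSaturated 𝓕 A → SettlesSchwarzschild 𝒟 𝓕.finalBondiMass

/-- D-C, piece X₂: JUNK NORMALISATION — every typed-saturated canonical foliation can be replaced by a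
NORMALISED saturated one with the same final Bondi mass. FALSE ON PAPER: it is precisely the defect the
refuters exhibited (junk `𝓕` has `finalBondiMass = m* ≠ M_f`, every normalised one has `M_f`). -/
def JunkNormalisation : Prop :=
  ∀ (X : Type) [TopologicalSpace X] [ChartedSpace E3 X] [IsManifold (𝓡 3) ∞ X] [T2Space X]
    [SecondCountableTopology X] [ConnectedSpace X],
    ∀ D ∈ admissibleVacuumData X, ∀ 𝒟 : VacuumCauchyDevelopment D, 𝒟.IsMaximal →
      Summit.FinalStateConjecture.HasCompleteNullInfinity 𝒟.toCauchyDevelopment → HasHorizon 𝒟 →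
      ∀ (e : AFEnd X) (𝓕 : 𝒟.toCauchyDevelopment.FutureBondiFoliation), 𝓕.IsCanonical e D →
        ∀ A : ℝ, IsSaturated 𝓕 A →
          ∃ (𝓕' : 𝒟.toCauchyDevelopment.FutureBondiFoliation) (A' : ℝ),
            𝓕'.IsCanonical e D ∧ IsNormalised 𝓕' ∧ IsSaturated 𝓕' A' ∧
              𝓕'.finalBondiMass = 𝓕.finalBondiMass

/-- Post-re-type split of C′, piece P2a (the ENGINE; open): on NORMALISED late cones, pinching of the
Hawking masses forces cone-level Schwarzschild(`m`) closeness — the null-Penrose flux identity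
`d m_H/ds = ∫Φ`, `Φ ≥ 0` termwise on doubly-convex constant-mass-aspect/affine leaves, integrates the
weighted shear/torsion/mass-aspect defect against the gain (Roesch Thm 1.1, Sauter Thm 4.1, Alexakis L. 19). -/
def SaturatedConeRigidity : Prop :=
  ∀ (X : Type) [TopologicalSpace X] [ChartedSpace E3 X] [IsManifold (𝓡 3) ∞ X] [ConnectedSpace X],
    ∀ (D : InitialDataSet (𝓡 3) X) (𝒟 : VacuumCauchyDevelopment D) (e : AFEnd X)
      (𝓕 : 𝒟.toCauchyDevelopment.FutureBondiFoliation), 𝓕.IsCanonical e D → IsNormalised 𝓕 →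
      ∀ m : ℝ, IsPinched 𝓕 m → ConesSchwarzschildClose 𝓕 m

/-- Post-re-type split of C′, piece P2b (open): CHART SYNTHESIS — a censored MGHD with complete `𝓘⁺`,
an event horizon and a normalised canonical foliation whose late cones are Schwarzschild(`M_B(∞)`)-close
(and whose inner leaves hug with areas `→ 16π M_B(∞)²`) settles in the T2 sense to one Schwarzschild hole
of mass `M_B(∞)` (quantitative Birkhoff along cones sweeping the d.o.c. / DHRT entry; horizon-normalised
Kerr–Schild charts; interior rays incomplete). -/
def SchwarzschildConesToCharts : Prop :=
  ∀ (X : Type) [TopologicalSpace X] [ChartedSpace E3 X] [IsManifold (𝓡 3) ∞ X] [T2Space X]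
    [SecondCountableTopology X] [ConnectedSpace X],
    ∀ D ∈ admissibleVacuumData X, ∀ 𝒟 : VacuumCauchyDevelopment D, 𝒟.IsMaximal →
      Summit.FinalStateConjecture.HasCompleteNullInfinity 𝒟.toCauchyDevelopment → HasHorizon 𝒟 →
      ∀ (e : AFEnd X) (𝓕 : 𝒟.toCauchyDevelopment.FutureBondiFoliation), 𝓕.IsCanonical e D →
        IsNormalised 𝓕 → ConesSchwarzschildClose 𝓕 𝓕.finalBondiMass →
        ∀ A : ℝ, 0 < A → Tendsto (innerArea 𝓕) atTop (𝓝 A) →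
          𝓕.finalBondiMass = Real.sqrt (A / (16 * Real.pi)) →
            SettlesSchwarzschild 𝒟 𝓕.finalBondiMass

/-! ## P1 is a theorem (provable now, proved here): the pinching lemma -/

/-- **P1 holds**: pure order/filter analysis over `IsCanonical` — for late `u` and `s ≥ 0`,
`m - ε ≤ m_H(S_{u,0}) ≤ m_H(S_{u,s}) ≤ M_B(u) ≤ m + ε`, using `HasBondiMass u (M_B u)` (limit of a
monotone-on-`[0,∞)` function bounds it from above), Bondi mass loss and `M_B(u) → M_B(∞) = m`. -/
theorem hawkingMassPinching : HawkingMassPinching := by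
  intro X _ _ _ _ D 𝒟 e 𝓕 hc hmono m hm0 hfin ε hε
  -- the Bondi masses converge to the final Bondi mass `= m`
  have hB : Tendsto 𝓕.bondiMass atTop (𝓝 m) := by
    have h := hc.hasFinalBondiMass
    have heq := h.finalBondiMass_eq
    rw [← heq, hfin] at h
    exact h
  have h1 : ∀ᶠ u in atTop, 𝓕.bondiMass u ≤ m + ε :=
    hB.eventually (eventually_le_nhds (by linarith))
  have h2 : ∀ᶠ u in atTop, m - ε ≤ 𝓕.sectionHawkingMass u 0 :=
    hm0.eventually (eventually_ge_nhds (by linarith))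
  filter_upwards [hmono, h1, h2] with u hmu hBu h0u s hs
  -- lower bound along the cone: monotonicity from the inner cut
  have hlow : 𝓕.sectionHawkingMass u 0 ≤ 𝓕.sectionHawkingMass u s :=
    hmu (Set.mem_Ici.2 le_rfl) (Set.mem_Ici.2 hs) hs
  -- upper bound along the cone: the monotone Hawking masses converge to `M_B(u)`
  have hup : 𝓕.sectionHawkingMass u s ≤ 𝓕.bondiMass u := by
    refine ge_of_tendsto (hc.hasBondiMass_bondiMass u) ?_
    filter_upwards [eventually_ge_atTop s] with s' hs'
    exact hmu (Set.mem_Ici.2 hs) (Set.mem_Ici.2 (hs.trans hs')) hs'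
  rw [abs_le]
  constructor <;> linarith

/-! ## Assemblies (all sorry-free; each concludes the crux `E` BY NAME, or C′) -/

/-- D-A assembly: P1 ∧ PinchedConesSettle → E. -/
theorem gainFreeConesSettle_of_pinching (h₁ : HawkingMassPinching) (h₂ : PinchedConesSettle) : E := by
  intro X _ _ _ _ _ _ D hD 𝒟 hmax hCNI hH e 𝓕 hc hmono A hA harea hmH hfin
  have hpinch : IsPinched 𝓕 𝓕.finalBondiMass :=
    h₁ X D 𝒟.toCauchyDevelopment e 𝓕 hc hmono 𝓕.finalBondiMass (by rw [hfin]; exact hmH) rfl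
  exact h₂ X D hD 𝒟 hmax hCNI hH e 𝓕 hc hpinch A hA harea hfin

/-- D-A degenerates: since P1 is a theorem, the single piece `PinchedConesSettle` already implies the
crux — it is (at least) E reworded modulo a provable lemma, so D-A violates (c). -/
theorem gainFreeConesSettle_of_pinchedConesSettle (h : PinchedConesSettle) : E :=
  gainFreeConesSettle_of_pinching hawkingMassPinching h

/-- D-B assembly: SaturatedDevelopmentsSettle ∧ SaturationPinsParameters → E. -/
theorem gainFreeConesSettle_of_settle_and_pin (h₁ : SaturatedDevelopmentsSettle)
    (h₂ : SaturationPinsParameters) : E := by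
  intro X _ _ _ _ _ _ D hD 𝒟 hmax hCNI hH e 𝓕 hc hmono A hA harea hmH hfin
  have hsat : IsSaturated 𝓕 A := ⟨hmono, hA, harea, hmH, hfin⟩
  obtain ⟨O, d, hsub, hO, hrays, hexh, hfo⟩ := h₁ X D hD 𝒟 hmax hCNI hH e 𝓕 hc A hsat
  obtain ⟨hN, hpar⟩ := h₂ X D hD 𝒟 hmax hCNI hH e 𝓕 hc A hsat O d hO hexh hfo
  exact ⟨O, d, hsub, hO, hrays, hexh, hfo, hN, hpar⟩

/-- D-C assembly: C′ ∧ JunkNormalisation → E. -/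
theorem gainFreeConesSettle_of_normalisation (h₁ : GainFreeConesSettleNormalised)
    (h₂ : JunkNormalisation) : E := by
  intro X _ _ _ _ _ _ D hD 𝒟 hmax hCNI hH e 𝓕 hc hmono A hA harea hmH hfin
  have hsat : IsSaturated 𝓕 A := ⟨hmono, hA, harea, hmH, hfin⟩
  obtain ⟨𝓕', A', hc', hnorm, hsat', hmass⟩ := h₂ X D hD 𝒟 hmax hCNI hH e 𝓕 hc A hsat
  have h := h₁ X D hD 𝒟 hmax hCNI hH e 𝓕' hc' hnorm A' hsat'
  rw [hmass] at h
  exact h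

/-- Post-re-type assembly: P1 ∧ P2a ∧ P2b → C′ (the split recommended for the re-typed node). -/
theorem gainFreeConesSettleNormalised_of_subs (h₁ : HawkingMassPinching) (h₂ : SaturatedConeRigidity)
    (h₃ : SchwarzschildConesToCharts) : GainFreeConesSettleNormalised := by
  intro X _ _ _ _ _ _ D hD 𝒟 hmax hCNI hH e 𝓕 hc hnorm A hsat
  obtain ⟨hmono, hA, harea, hmH, hfin⟩ := hsat
  have hpinch : IsPinched 𝓕 𝓕.finalBondiMass :=
    h₁ X D 𝒟.toCauchyDevelopment e 𝓕 hc hmono 𝓕.finalBondiMass (by rw [hfin]; exact hmH) rfl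
  have hclose : ConesSchwarzschildClose 𝓕 𝓕.finalBondiMass := h₂ X D 𝒟 e 𝓕 hc hnorm _ hpinch
  exact h₃ X D hD 𝒟 hmax hCNI hH e 𝓕 hc hnorm hclose A hA harea hfin

/-- Sanity: C′ is E weakened by the normalisation hypothesis (E → C′ by forgetting it). -/
theorem gainFreeConesSettleNormalised_of_gainFreeConesSettle (h : E) :
    GainFreeConesSettleNormalised := by
  intro X _ _ _ _ _ _ D hD 𝒟 hmax hCNI hH e 𝓕 hc _ A hsat
  obtain ⟨hmono, hA, harea, hmH, hfin⟩ := hsat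
  exact h X D hD 𝒟 hmax hCNI hH e 𝓕 hc hmono A hA harea hmH hfin


/-! ## RE-TYPE KIT (hand-over for the tenure planner / human; NOT filed by this seat)

The crux as typed is HELD for a planner re-type of its saturation predicate. Below, written over
TREE declarations only (paste-ready for `ledger route edit --restate … --statement '<body>'` or
`workitem add … --signature`), with the normalisation (N0)–(N3) INLINED:

* `GainFreeConesSettleR`      — E′ = C′ : the crux with the normalisation hypothesis inserted after
                                 `𝓕.IsCanonical e D` (everything else verbatim, curried as in E);
* `PenroseConesExistR`        — K1′ : rank-4 crux with the same normalisation added to its `∃`;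
* `UnsaturatedSectorSettlesR` — R′  : rank-5 crux with the normalised saturation predicate negated;
* `closesR`                   — the deciding theorem re-elaborated over (E′, R′, H, S), same proof
                                 shape as the route's `closes` (H, S are the route's own decls);
* `closes1`                   — the intermediate deciding theorem over (E, R′, H, S) for the first of the
                                 three one-decl `--restate` edits (end of file);
* `HawkingMassPinchingR` (= P1, PROVED), `SaturatedConeRigidityR` (P2a), `SchwarzschildConesToChartsR`
  (P2b) and `gainFreeConesSettleR_of_subs : P1 → P2a → P2b → E′` (PROVED) — the post-re-type split;
* `Iff` lemmas tying each inlined body to the helper-based defs above (consistency checks).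

Extra import needed by the route file after the re-type: `Literature.Geometry.Lorentzian.HawkingMassFlux`
(for `BondiFoliation.IsAdaptedCone`, `coneNullHypersurface`, `NullHypersurface.*`). -/

/-- E′ = C′ (paste-ready body). -/
def GainFreeConesSettleR : Prop :=
  open Literature.Geometry.Lorentzian in ∀ (X : Type) [TopologicalSpace X] [ChartedSpace E3 X] [IsManifold (𝓡 3) ((⊤ : ℕ∞) : WithTop ℕ∞) X] [T2Space X] [SecondCountableTopology X] [ConnectedSpace X], ∀ D ∈ admissibleVacuumData X, ∀ 𝒟 : VacuumCauchyDevelopment D, 𝒟.IsMaximal → Summit.FinalStateConjecture.HasCompleteNullInfinity 𝒟.toCauchyDevelopment → (∀ [𝒟.metric.HasLeviCivita], ∃ q : 𝒟.carrier, ∀ (p : X) (γ : ℝ → 𝒟.carrier) (dom : Set ℝ), 𝒟.metric.IsNormalisedNullRayFrom 𝒟.timeOrientation 𝒟.embed 𝒟.normal p γ dom → ¬ BddAbove dom → q ∉ 𝒟.metric.chronologicalPast 𝒟.timeOrientation (γ '' (dom ∩ Set.Ici 0))) → ∀ (e : AFEnd X) (𝓕 : 𝒟.toCauchyDevelopment.FutureBondiFoliation),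 𝓕.IsCanonical e D → (ConnectedSpace 𝓕.surf ∧ (∀ᶠ u in atTop, 𝓕.IsAdaptedCone u ∧ ∀ y : 𝓕.surf, IsGeodesicOn (haveI := 𝒟.metric.toPseudoRiemannianMetric.hasLeviCivita; 𝒟.metric.leviCivita) (fun s ↦ 𝓕.sec u s y) (Set.Ioi 0)) ∧ (∀ᶠ u in atTop, TendstoUniformly (fun s y ↦ 𝒟.metric.gaussCurvature (𝓕.sec u s) (𝓕.isSpacelike u s) y * (totalArea (𝒟.metric.inducedRiemannianMetric (𝓕.sec u s) 𝓕.hpb (𝓕.isSpacelike u s))).toReal / (4 * Real.pi)) (fun _ ↦ (1 : ℝ)) atTop) ∧ (∀ ε : ℝ, 0 < ε → ∀ᶠ u in atTop, ∀ y : 𝓕.surf, haveI := 𝓕.hasLeviCivita; |𝒟.metric.nullExpansion (𝓕.sec u 0) 𝓕.hpb (𝓕.isSpacelike u 0) (𝓕.pair u 0).L y * 𝒟.metric.nullExpansion (𝓕.sec u 0) 𝓕.hpb (𝓕.isSpacelike u 0) (𝓕.pair u 0).Lbar y| ≤ ε)) → (∀ᶠ u in atTop, MonotoneOn (𝓕.sectionHawkingMass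 u) (Set.Ici 0)) → ∀ A : ℝ, 0 < A → Tendsto (fun u ↦ (totalArea (𝒟.metric.inducedRiemannianMetric (𝓕.sec u 0) 𝓕.hpb (𝓕.isSpacelike u 0))).toReal) atTop (𝓝 A) → Tendsto (fun u ↦ 𝓕.sectionHawkingMass u 0) atTop (𝓝 (Real.sqrt (A / (16 * Real.pi)))) → 𝓕.finalBondiMass = Real.sqrt (A / (16 * Real.pi)) → ∃ (O : Set 𝒟.carrier) (d : FinalStateDecomposition 𝒟.toSpacetime O 2), (∀ i, Kerr.IsSubextremal (d.mass i) (d.spin i)) ∧ O = Summit.FinalStateConjecture.exteriorOf 𝒟.toCauchyDevelopment d.charted ∧ Summit.FinalStateConjecture.RaysStayInClosure 𝒟.toCauchyDevelopment O ∧ Summit.FinalStateConjecture.HasExhaustiveCharts d ∧ Summit.FinalStateConjecture.IsFutureOriented d ∧ d.N = 1 ∧ ∀ i, d.spin i = 0 ∧ d.mass i = 𝓕.finalBondiMass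

/-- K1′ (paste-ready body). -/
def PenroseConesExistR : Prop :=
  open Literature.Geometry.Lorentzian in ∀ (X : Type) [TopologicalSpace X] [ChartedSpace E3 X] [IsManifold (𝓡 3) ((⊤ : ℕ∞) : WithTop ℕ∞) X] [T2Space X] [SecondCountableTopology X] [ConnectedSpace X], ∀ D ∈ admissibleVacuumData X, ∀ 𝒟 : VacuumCauchyDevelopment D, 𝒟.IsMaximal → Summit.FinalStateConjecture.HasCompleteNullInfinity 𝒟.toCauchyDevelopment → (∀ [𝒟.metric.HasLeviCivita], ∃ q : 𝒟.carrier, ∀ (p : X) (γ : ℝ → 𝒟.carrier) (dom : Set ℝ), 𝒟.metric.IsNormalisedNullRayFrom 𝒟.timeOrientation 𝒟.embed 𝒟.normal p γ dom → ¬ BddAbove dom → q ∉ 𝒟.metric.chronologicalPast 𝒟.timeOrientation (γ '' (dom ∩ Set.Ici 0))) → ∃ (e : AFEnd X) (𝓕 : 𝒟.toCauchyDevelopment.FutureBondiFoliation), 𝓕.IsCanonical e D ∧ (ConnectedSpace 𝓕.surf ∧ (∀ᶠ u in atTop, 𝓕.IsAdaptedCone u ∧ ∀ y : 𝓕.surf,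 IsGeodesicOn (haveI := 𝒟.metric.toPseudoRiemannianMetric.hasLeviCivita; 𝒟.metric.leviCivita) (fun s ↦ 𝓕.sec u s y) (Set.Ioi 0)) ∧ (∀ᶠ u in atTop, TendstoUniformly (fun s y ↦ 𝒟.metric.gaussCurvature (𝓕.sec u s) (𝓕.isSpacelike u s) y * (totalArea (𝒟.metric.inducedRiemannianMetric (𝓕.sec u s) 𝓕.hpb (𝓕.isSpacelike u s))).toReal / (4 * Real.pi)) (fun _ ↦ (1 : ℝ)) atTop) ∧ (∀ ε : ℝ, 0 < ε → ∀ᶠ u in atTop, ∀ y : 𝓕.surf, haveI := 𝓕.hasLeviCivita; |𝒟.metric.nullExpansion (𝓕.sec u 0) 𝓕.hpb (𝓕.isSpacelike u 0) (𝓕.pair u 0).L y * 𝒟.metric.nullExpansion (𝓕.sec u 0) 𝓕.hpb (𝓕.isSpacelike u 0) (𝓕.pair u 0).Lbar y| ≤ ε)) ∧ (∀ᶠ u in atTop, MonotoneOn (𝓕.sectionHawkingMass u) (Set.Ici 0)) ∧ ∃ A : ℝ, 0 < A ∧ Tendsto (fun u ↦ (totalArea (𝒟.metric.inducedRiemannianMetric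 (𝓕.sec u 0) 𝓕.hpb (𝓕.isSpacelike u 0))).toReal) atTop (𝓝 A) ∧ Tendsto (fun u ↦ 𝓕.sectionHawkingMass u 0) atTop (𝓝 (Real.sqrt (A / (16 * Real.pi))))

/-- R′ (paste-ready body). -/
def UnsaturatedSectorSettlesR : Prop :=
  open Literature.Geometry.Lorentzian in ∀ (X : Type) [TopologicalSpace X] [ChartedSpace E3 X] [IsManifold (𝓡 3) ((⊤ : ℕ∞) : WithTop ℕ∞) X] [T2Space X] [SecondCountableTopology X] [ConnectedSpace X], InitialDataSet.IsTameChristodoulouGeneric (admissibleVacuumData X) (fun D ↦ ∀ 𝒟 : VacuumCauchyDevelopment D, 𝒟.IsMaximal → Summit.FinalStateConjecture.HasCompleteNullInfinity 𝒟.toCauchyDevelopment ∧ ((∀ [𝒟.metric.HasLeviCivita], ∃ q : 𝒟.carrier, ∀ (p : X) (γ : ℝ → 𝒟.carrier) (dom : Set ℝ), 𝒟.metric.IsNormalisedNullRayFrom 𝒟.timeOrientation 𝒟.embed 𝒟.normal p γ dom → ¬ BddAbove dom → q ∉ 𝒟.metric.chronologicalPast 𝒟.timeOrientation (γ '' (dom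 ∩ Set.Ici 0))) → ¬ (∃ (e : AFEnd X) (𝓕 : 𝒟.toCauchyDevelopment.FutureBondiFoliation), 𝓕.IsCanonical e D ∧ (ConnectedSpace 𝓕.surf ∧ (∀ᶠ u in atTop, 𝓕.IsAdaptedCone u ∧ ∀ y : 𝓕.surf, IsGeodesicOn (haveI := 𝒟.metric.toPseudoRiemannianMetric.hasLeviCivita; 𝒟.metric.leviCivita) (fun s ↦ 𝓕.sec u s y) (Set.Ioi 0)) ∧ (∀ᶠ u in atTop, TendstoUniformly (fun s y ↦ 𝒟.metric.gaussCurvature (𝓕.sec u s) (𝓕.isSpacelike u s) y * (totalArea (𝒟.metric.inducedRiemannianMetric (𝓕.sec u s) 𝓕.hpb (𝓕.isSpacelike u s))).toReal / (4 * Real.pi)) (fun _ ↦ (1 : ℝ)) atTop) ∧ (∀ ε : ℝ, 0 < ε → ∀ᶠ u in atTop, ∀ y : 𝓕.surf, haveI := 𝓕.hasLeviCivita; |𝒟.metric.nullExpansion (𝓕.sec u 0) 𝓕.hpb (𝓕.isSpacelike u 0) (𝓕.pair u 0).L y * 𝒟.metric.nullExpansion (𝓕.sec u 0) 𝓕.hpb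 (𝓕.isSpacelike u 0) (𝓕.pair u 0).Lbar y| ≤ ε)) ∧ (∀ᶠ u in atTop, MonotoneOn (𝓕.sectionHawkingMass u) (Set.Ici 0)) ∧ ∃ A : ℝ, 0 < A ∧ Tendsto (fun u ↦ (totalArea (𝒟.metric.inducedRiemannianMetric (𝓕.sec u 0) 𝓕.hpb (𝓕.isSpacelike u 0))).toReal) atTop (𝓝 A) ∧ Tendsto (fun u ↦ 𝓕.sectionHawkingMass u 0) atTop (𝓝 (Real.sqrt (A / (16 * Real.pi)))) ∧ 𝓕.finalBondiMass = Real.sqrt (A / (16 * Real.pi))) → ∃ (O : Set 𝒟.carrier) (d : FinalStateDecomposition 𝒟.toSpacetime O 2), (∀ i, Kerr.IsSubextremal (d.mass i) (d.spin i)) ∧ O = Summit.FinalStateConjecture.exteriorOf 𝒟.toCauchyDevelopment d.charted ∧ Summit.FinalStateConjecture.RaysStayInClosure 𝒟.toCauchyDevelopment O ∧ Summit.FinalStateConjecture.HasExhaustiveCharts d ∧ Summit.FinalStateConjecture.IsFutureOriented d)) 1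

/-- P1 inlined (paste-ready body; PROVED below from `hawkingMassPinching`). -/
def HawkingMassPinchingR : Prop :=
  open Literature.Geometry.Lorentzian in ∀ (X : Type) [TopologicalSpace X] [ChartedSpace E3 X] [IsManifold (𝓡 3) ((⊤ : ℕ∞) : WithTop ℕ∞) X] [ConnectedSpace X], ∀ (D : InitialDataSet (𝓡 3) X) (𝒟 : CauchyDevelopment D) (e : AFEnd X) (𝓕 : 𝒟.FutureBondiFoliation), 𝓕.IsCanonical e D → (∀ᶠ u in atTop, MonotoneOn (𝓕.sectionHawkingMass u) (Set.Ici 0)) → ∀ m : ℝ, Tendsto (fun u ↦ 𝓕.sectionHawkingMass u 0) atTop (𝓝 m) → 𝓕.finalBondiMass = m → (∀ ε : ℝ, 0 < ε → ∀ᶠ u in atTop, ∀ s : ℝ, 0 ≤ s → |𝓕.sectionHawkingMass u s - m| ≤ ε)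

/-- P2a inlined (paste-ready body). -/
def SaturatedConeRigidityR : Prop :=
  open Literature.Geometry.Lorentzian in ∀ (X : Type) [TopologicalSpace X] [ChartedSpace E3 X] [IsManifold (𝓡 3) ((⊤ : ℕ∞) : WithTop ℕ∞) X] [ConnectedSpace X], ∀ (D : InitialDataSet (𝓡 3) X) (𝒟 : VacuumCauchyDevelopment D) (e : AFEnd X) (𝓕 : 𝒟.toCauchyDevelopment.FutureBondiFoliation), 𝓕.IsCanonical e D → (ConnectedSpace 𝓕.surf ∧ (∀ᶠ u in atTop, 𝓕.IsAdaptedCone u ∧ ∀ y : 𝓕.surf, IsGeodesicOn (haveI := 𝒟.metric.toPseudoRiemannianMetric.hasLeviCivita; 𝒟.metric.leviCivita) (fun s ↦ 𝓕.sec u s y) (Set.Ioi 0)) ∧ (∀ᶠ u in atTop, TendstoUniformly (fun s y ↦ 𝒟.metric.gaussCurvature (𝓕.sec u s) (𝓕.isSpacelike u s) y * (totalArea (𝒟.metric.inducedRiemannianMetric (𝓕.sec u s) 𝓕.hpb (𝓕.isSpacelike u s))).toReal / (4 * Real.pi)) (fun _ ↦ (1 : ℝ)) atTop) ∧ (∀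 ε : ℝ, 0 < ε → ∀ᶠ u in atTop, ∀ y : 𝓕.surf, haveI := 𝓕.hasLeviCivita; |𝒟.metric.nullExpansion (𝓕.sec u 0) 𝓕.hpb (𝓕.isSpacelike u 0) (𝓕.pair u 0).L y * 𝒟.metric.nullExpansion (𝓕.sec u 0) 𝓕.hpb (𝓕.isSpacelike u 0) (𝓕.pair u 0).Lbar y| ≤ ε)) → ∀ m : ℝ, (∀ ε : ℝ, 0 < ε → ∀ᶠ u in atTop, ∀ s : ℝ, 0 ≤ s → |𝓕.sectionHawkingMass u s - m| ≤ ε) → (∀ ε : ℝ, 0 < ε → ∀ᶠ u in atTop, ∀ hu : 𝓕.IsAdaptedCone u, ∀ s : ℝ, 0 ≤ s → ∀ y : (LorentzianMetric.BondiFoliation.coneNullHypersurface hu).surf, (LorentzianMetric.BondiFoliation.coneNullHypersurface hu).areaRadius s ^ 2 * ((LorentzianMetric.BondiFoliation.coneNullHypersurface hu).shearNormSq s y + (LorentzianMetric.BondiFoliation.coneNullHypersurface hu).torsionNormSq s y) + (LorentzianMetric.BondiFoliation.coneNullHypersurface hu).areaRadius s ^ 3 * |(LorentzianMetric.BondiFoliation.coneNullHypersurface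 hu).massAspect s y - (LorentzianMetric.BondiFoliation.coneNullHypersurface hu).meanMassAspect s| ≤ ε ∧ |(LorentzianMetric.BondiFoliation.coneNullHypersurface hu).hawkingMass s - m| ≤ ε)

/-- P2b inlined (paste-ready body). -/
def SchwarzschildConesToChartsR : Prop :=
  open Literature.Geometry.Lorentzian in ∀ (X : Type) [TopologicalSpace X] [ChartedSpace E3 X] [IsManifold (𝓡 3) ((⊤ : ℕ∞) : WithTop ℕ∞) X] [T2Space X] [SecondCountableTopology X] [ConnectedSpace X], ∀ D ∈ admissibleVacuumData X, ∀ 𝒟 : VacuumCauchyDevelopment D, 𝒟.IsMaximal → Summit.FinalStateConjecture.HasCompleteNullInfinity 𝒟.toCauchyDevelopment → (∀ [𝒟.metric.HasLeviCivita], ∃ q : 𝒟.carrier, ∀ (p : X) (γ : ℝ → 𝒟.carrier) (dom : Set ℝ), 𝒟.metric.IsNormalisedNullRayFrom 𝒟.timeOrientation 𝒟.embed 𝒟.normal p γ dom → ¬ BddAbove dom → q ∉ 𝒟.metric.chronologicalPast 𝒟.timeOrientation (γ '' (dom ∩ Set.Ici 0))) → ∀ (e : AFEnd X) (𝓕 :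 𝒟.toCauchyDevelopment.FutureBondiFoliation), 𝓕.IsCanonical e D → (ConnectedSpace 𝓕.surf ∧ (∀ᶠ u in atTop, 𝓕.IsAdaptedCone u ∧ ∀ y : 𝓕.surf, IsGeodesicOn (haveI := 𝒟.metric.toPseudoRiemannianMetric.hasLeviCivita; 𝒟.metric.leviCivita) (fun s ↦ 𝓕.sec u s y) (Set.Ioi 0)) ∧ (∀ᶠ u in atTop, TendstoUniformly (fun s y ↦ 𝒟.metric.gaussCurvature (𝓕.sec u s) (𝓕.isSpacelike u s) y * (totalArea (𝒟.metric.inducedRiemannianMetric (𝓕.sec u s) 𝓕.hpb (𝓕.isSpacelike u s))).toReal / (4 * Real.pi)) (fun _ ↦ (1 : ℝ)) atTop) ∧ (∀ ε : ℝ, 0 < ε → ∀ᶠ u in atTop, ∀ y : 𝓕.surf, haveI := 𝓕.hasLeviCivita; |𝒟.metric.nullExpansion (𝓕.sec u 0) 𝓕.hpb (𝓕.isSpacelike u 0) (𝓕.pair u 0).L y * 𝒟.metric.nullExpansion (𝓕.sec u 0) 𝓕.hpb (𝓕.isSpacelike u 0) (𝓕.pair u 0).Lbar y| ≤ ε)) →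 (∀ ε : ℝ, 0 < ε → ∀ᶠ u in atTop, ∀ hu : 𝓕.IsAdaptedCone u, ∀ s : ℝ, 0 ≤ s → ∀ y : (LorentzianMetric.BondiFoliation.coneNullHypersurface hu).surf, (LorentzianMetric.BondiFoliation.coneNullHypersurface hu).areaRadius s ^ 2 * ((LorentzianMetric.BondiFoliation.coneNullHypersurface hu).shearNormSq s y + (LorentzianMetric.BondiFoliation.coneNullHypersurface hu).torsionNormSq s y) + (LorentzianMetric.BondiFoliation.coneNullHypersurface hu).areaRadius s ^ 3 * |(LorentzianMetric.BondiFoliation.coneNullHypersurface hu).massAspect s y - (LorentzianMetric.BondiFoliation.coneNullHypersurface hu).meanMassAspect s| ≤ ε ∧ |(LorentzianMetric.BondiFoliation.coneNullHypersurface hu).hawkingMass s - 𝓕.finalBondiMass| ≤ ε) → ∀ A : ℝ, 0 < A → Tendsto (fun u ↦ (totalArea (𝒟.metric.inducedRiemannianMetric (𝓕.sec u 0) 𝓕.hpb (𝓕.isSpacelike u 0))).toReal) atTop (𝓝 A) → 𝓕.finalBondiMass = Real.sqrt (A / (16 * Real.pi)) → ∃ (O : Set 𝒟.carrier) (d : FinalStateDecomposition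 𝒟.toSpacetime O 2), (∀ i, Kerr.IsSubextremal (d.mass i) (d.spin i)) ∧ O = Summit.FinalStateConjecture.exteriorOf 𝒟.toCauchyDevelopment d.charted ∧ Summit.FinalStateConjecture.RaysStayInClosure 𝒟.toCauchyDevelopment O ∧ Summit.FinalStateConjecture.HasExhaustiveCharts d ∧ Summit.FinalStateConjecture.IsFutureOriented d ∧ d.N = 1 ∧ ∀ i, d.spin i = 0 ∧ d.mass i = 𝓕.finalBondiMass

/-! ### Consistency of the inlined bodies with the helper-based defs -/

theorem hawkingMassPinchingR_iff : HawkingMassPinchingR ↔ HawkingMassPinching := Iff.rfl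

theorem saturatedConeRigidityR_iff : SaturatedConeRigidityR ↔ SaturatedConeRigidity := Iff.rfl

theorem gainFreeConesSettleR_iff : GainFreeConesSettleR ↔ GainFreeConesSettleNormalised := by
  constructor
  · intro h X _ _ _ _ _ _ D hD 𝒟 hmax hCNI hH e 𝓕 hc hnorm A hsat
    obtain ⟨hmono, hA, harea, hmH, hfin⟩ := hsat
    exact h X D hD 𝒟 hmax hCNI hH e 𝓕 hc hnorm hmono A hA harea hmH hfin
  · intro h X _ _ _ _ _ _ D hD 𝒟 hmax hCNI hH e 𝓕 hc hnorm hmono A hA harea hmH hfin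
    exact h X D hD 𝒟 hmax hCNI hH e 𝓕 hc hnorm A ⟨hmono, hA, harea, hmH, hfin⟩

theorem schwarzschildConesToChartsR_iff :
    SchwarzschildConesToChartsR ↔ SchwarzschildConesToCharts := Iff.rfl

/-- P1 inlined is a theorem. -/
theorem hawkingMassPinchingR : HawkingMassPinchingR :=
  hawkingMassPinchingR_iff.2 hawkingMassPinching

/-- The re-type WEAKENS the node: E → E′ (forget the normalisation hypothesis). -/
theorem gainFreeConesSettleR_of_gainFreeConesSettle (h : E) : GainFreeConesSettleR := by
  intro X _ _ _ _ _ _ D hD 𝒟 hmax hCNI hH e 𝓕 hc _ hmono A hA harea hmH hfin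
  exact h X D hD 𝒟 hmax hCNI hH e 𝓕 hc hmono A hA harea hmH hfin

/-- POST-RE-TYPE SPLIT, assembly PROVED: P1 → P2a → P2b → E′ (P1 is a theorem, so effectively
P2a ∧ P2b → E′; the seam threads the pinching conclusion into the cone rigidity and the rigidity
conclusion into the chart synthesis — not an `exact ⟨h₁, h₂⟩` join). -/
theorem gainFreeConesSettleR_of_subs (h₁ : HawkingMassPinchingR) (h₂ : SaturatedConeRigidityR)
    (h₃ : SchwarzschildConesToChartsR) : GainFreeConesSettleR := by
  intro X _ _ _ _ _ _ D hD 𝒟 hmax hCNI hH e 𝓕 hc hnorm hmono A hA harea hmH hfin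
  -- P1: monotonicity + inner masses → M_B(∞) pinch every late Hawking mass to M_B(∞)
  have hpinch : ∀ ε : ℝ, 0 < ε → ∀ᶠ u in atTop, ∀ s : ℝ, 0 ≤ s →
      |𝓕.sectionHawkingMass u s - 𝓕.finalBondiMass| ≤ ε :=
    h₁ X D 𝒟.toCauchyDevelopment e 𝓕 hc hmono 𝓕.finalBondiMass (by rw [hfin]; exact hmH) rfl
  -- P2a: on normalised cones, pinching ⇒ cone-level Schwarzschild(M_B(∞)) closeness
  have hclose := h₂ X D 𝒟 e 𝓕 hc hnorm 𝓕.finalBondiMass hpinch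
  -- P2b: Schwarzschild-close normalised late cones + hugging areas ⇒ exhaustive C² charts
  exact h₃ X D hD 𝒟 hmax hCNI hH e 𝓕 hc hnorm hclose A hA harea hfin

/-- E′ ∧ P2-split sanity in the other direction is NOT claimed (P2a, P2b are genuinely stronger
in kind than E′: uniform cone-level statements). -/
example : True := trivial

/-! ### The deciding theorem re-elaborated over the re-typed items (same shape as `closes`) -/

open Summit.FinalStateConjecture.FinalStateConjecture.Theses.PenroseDeficitNorm in
/-- `closesR : E′ → R′ → H → S → FinalStateConjecture` — H = `CensoredHorizonlessDisperseT2`,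
S = `MGHDExists` are the route's own (unchanged) decls. -/
theorem closesR (h₁ : GainFreeConesSettleR) (h₂ : UnsaturatedSectorSettlesR)
    (h₃ : CensoredHorizonlessDisperseT2) (h₄ : MGHDExists) : FinalStateConjecture := by
  intro X _ _ _ _ _ _
  have mono : ∀ {P Q : Literature.Geometry.Lorentzian.InitialDataSet (modelWithCornersSelf ℝ (EuclideanSpace ℝ (Fin 3))) X → Prop},
      Literature.Geometry.Lorentzian.InitialDataSet.IsTameChristodoulouGeneric
          (Literature.Geometry.Lorentzian.admissibleVacuumData X) P 1 →
        (∀ D ∈ Literature.Geometry.Lorentzian.admissibleVacuumData X, P D → Q D) →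
          Literature.Geometry.Lorentzian.InitialDataSet.IsTameChristodoulouGeneric
            (Literature.Geometry.Lorentzian.admissibleVacuumData X) Q 1 := by
    intro P Q h hPQ d hd
    obtain ⟨e, F, hF, himm, h0, hinj, hDF, hE⟩ := h d ⟨hd.1, fun hP => hd.2 (hPQ d hd.1 hP)⟩
    exact ⟨e, F, hF, himm, h0, hinj, hDF,
      fun c hc hc' => hE c hc ⟨hc'.1, fun hP => hc'.2 (hPQ _ hc'.1 hP)⟩⟩
  refine mono (h₂ X) ?_
  intro D hD hP
  refine ⟨h₄ X D hD, fun 𝒟 h𝒟 => ?_⟩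
  obtain ⟨hCNI, hrest⟩ := hP 𝒟 h𝒟
  refine ⟨hCNI, ?_⟩
  by_cases hH : (∀ [𝒟.metric.HasLeviCivita], ∃ q : 𝒟.carrier, ∀ (p : X) (γ : ℝ → 𝒟.carrier) (dom : Set ℝ), 𝒟.metric.IsNormalisedNullRayFrom 𝒟.timeOrientation 𝒟.embed 𝒟.normal p γ dom → ¬ BddAbove dom → q ∉ 𝒟.metric.chronologicalPast 𝒟.timeOrientation (γ '' (dom ∩ Set.Ici 0)))
  · by_cases hSat : (∃ (e : AFEnd X) (𝓕 : 𝒟.toCauchyDevelopment.FutureBondiFoliation), 𝓕.IsCanonical e D ∧ (ConnectedSpace 𝓕.surf ∧ (∀ᶠ u in atTop, 𝓕.IsAdaptedCone u ∧ ∀ y : 𝓕.surf, IsGeodesicOn (haveI := 𝒟.metric.toPseudoRiemannianMetric.hasLeviCivita; 𝒟.metric.leviCivita) (fun s ↦ 𝓕.sec u s y) (Set.Ioi 0)) ∧ (∀ᶠ u in atTop, TendstoUniformly (fun s y ↦ 𝒟.metric.gaussCurvature (𝓕.sec u s) (𝓕.isSpacelike u s) y * (totalArea (𝒟.metric.inducedRiemannianMetric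 (𝓕.sec u s) 𝓕.hpb (𝓕.isSpacelike u s))).toReal / (4 * Real.pi)) (fun _ ↦ (1 : ℝ)) atTop) ∧ (∀ ε : ℝ, 0 < ε → ∀ᶠ u in atTop, ∀ y : 𝓕.surf, haveI := 𝓕.hasLeviCivita; |𝒟.metric.nullExpansion (𝓕.sec u 0) 𝓕.hpb (𝓕.isSpacelike u 0) (𝓕.pair u 0).L y * 𝒟.metric.nullExpansion (𝓕.sec u 0) 𝓕.hpb (𝓕.isSpacelike u 0) (𝓕.pair u 0).Lbar y| ≤ ε)) ∧ (∀ᶠ u in atTop, MonotoneOn (𝓕.sectionHawkingMass u) (Set.Ici 0)) ∧ ∃ A : ℝ, 0 < A ∧ Tendsto (fun u ↦ (totalArea (𝒟.metric.inducedRiemannianMetric (𝓕.sec u 0) 𝓕.hpb (𝓕.isSpacelike u 0))).toReal) atTop (𝓝 A) ∧ Tendsto (fun u ↦ 𝓕.sectionHawkingMass u 0) atTop (𝓝 (Real.sqrt (A / (16 * Real.pi)))) ∧ 𝓕.finalBondiMass = Real.sqrt (A / (16 * Real.pi)))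
    · obtain ⟨e, 𝓕, hc, hnorm, hmono, A, hA, harea, hmH, hfin⟩ := hSat
      obtain ⟨O, d, hsub, hO, hrays, hex, hfo, -⟩ :=
        h₁ X D hD 𝒟 h𝒟 hCNI hH e 𝓕 hc hnorm hmono A hA harea hmH hfin
      exact ⟨O, d, hsub, hO, hrays, hex, hfo⟩
    · exact hrest hH hSat
  · obtain ⟨O, d, hN, hO, hrays, hE, hfo⟩ := h₃ X D hD 𝒟 h𝒟 hCNI hH
    exact ⟨O, d, fun i ↦ (Fin.cast hN i).elim0, hO, hrays, hE, hfo⟩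

open Summit.FinalStateConjecture.FinalStateConjecture.Theses.PenroseDeficitNorm in
/-- INTERMEDIATE deciding theorem for the FIRST edit of the sequence (`--restate UnsaturatedSectorSettles` alone;
`--restate` is one decl per edit and every edit must re-typecheck the deciding theorem): `closes1 : E → R′ → H → S →
FinalStateConjecture`, by cases on the OLD saturation predicate — a normalised saturated foliation is in particular a
typed-saturated one, so `¬ old ⇒ ¬ new` feeds R′. -/
theorem closes1 (h₁ : E) (h₂ : UnsaturatedSectorSettlesR)
    (h₃ : CensoredHorizonlessDisperseT2) (h₄ : MGHDExists) : FinalStateConjecture := by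
  intro X _ _ _ _ _ _
  have mono : ∀ {P Q : Literature.Geometry.Lorentzian.InitialDataSet (modelWithCornersSelf ℝ (EuclideanSpace ℝ (Fin 3))) X → Prop},
      Literature.Geometry.Lorentzian.InitialDataSet.IsTameChristodoulouGeneric
          (Literature.Geometry.Lorentzian.admissibleVacuumData X) P 1 →
        (∀ D ∈ Literature.Geometry.Lorentzian.admissibleVacuumData X, P D → Q D) →
          Literature.Geometry.Lorentzian.InitialDataSet.IsTameChristodoulouGeneric
            (Literature.Geometry.Lorentzian.admissibleVacuumData X) Q 1 := by
    intro P Q h hPQ d hd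
    obtain ⟨e, F, hF, himm, h0, hinj, hDF, hE⟩ := h d ⟨hd.1, fun hP => hd.2 (hPQ d hd.1 hP)⟩
    exact ⟨e, F, hF, himm, h0, hinj, hDF,
      fun c hc hc' => hE c hc ⟨hc'.1, fun hP => hc'.2 (hPQ _ hc'.1 hP)⟩⟩
  refine mono (h₂ X) ?_
  intro D hD hP
  refine ⟨h₄ X D hD, fun 𝒟 h𝒟 => ?_⟩
  obtain ⟨hCNI, hrest⟩ := hP 𝒟 h𝒟
  refine ⟨hCNI, ?_⟩
  by_cases hH : (∀ [𝒟.metric.HasLeviCivita], ∃ q : 𝒟.carrier, ∀ (p : X) (γ : ℝ → 𝒟.carrier) (dom : Set ℝ), 𝒟.metric.IsNormalisedNullRayFrom 𝒟.timeOrientation 𝒟.embed 𝒟.normal p γ dom → ¬ BddAbove dom → q ∉ 𝒟.metric.chronologicalPast 𝒟.timeOrientation (γ '' (dom ∩ Set.Ici 0)))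
  · by_cases hSat : (∃ (e : AFEnd X) (𝓕 : 𝒟.toCauchyDevelopment.FutureBondiFoliation), 𝓕.IsCanonical e D ∧ (∀ᶠ u in atTop, MonotoneOn (𝓕.sectionHawkingMass u) (Set.Ici 0)) ∧ ∃ A : ℝ, 0 < A ∧ Tendsto (fun u ↦ (totalArea (𝒟.metric.inducedRiemannianMetric (𝓕.sec u 0) 𝓕.hpb (𝓕.isSpacelike u 0))).toReal) atTop (𝓝 A) ∧ Tendsto (fun u ↦ 𝓕.sectionHawkingMass u 0) atTop (𝓝 (Real.sqrt (A / (16 * Real.pi)))) ∧ 𝓕.finalBondiMass = Real.sqrt (A / (16 * Real.pi)))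
    · obtain ⟨e, 𝓕, hc, hmono, A, hA, harea, hmH, hfin⟩ := hSat
      obtain ⟨O, d, hsub, hO, hrays, hex, hfo, -⟩ :=
        h₁ X D hD 𝒟 h𝒟 hCNI hH e 𝓕 hc hmono A hA harea hmH hfin
      exact ⟨O, d, hsub, hO, hrays, hex, hfo⟩
    · refine hrest hH ?_
      rintro ⟨e, 𝓕, hc, -, hmono, A, hA, harea, hmH, hfin⟩
      exact hSat ⟨e, 𝓕, hc, hmono, A, hA, harea, hmH, hfin⟩
  · obtain ⟨O, d, hN, hO, hrays, hE, hfo⟩ := h₃ X D hD 𝒟 h𝒟 hCNI hH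
    exact ⟨O, d, fun i ↦ (Fin.cast hN i).elim0, hO, hrays, hE, hfo⟩

end Summit.FinalStateConjecture.FinalStateConjecture.Cruxes.GainFreeConesSettle.StrategyCensus

end
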